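import Mathlib.LinearAlgebra.FiniteDimensional.Defs
import Mathlib.LinearAlgebra.Dimension.Free
import Mathlib.Data.Matrix.Basic
import Mathlib.RingTheory.Finiteness.Basic
import HarnessLib

/-!
# Route `PhantomRMYoshida`, support item `PhantomRMTransport` (stmt-Langlands-13641): the commutant
# of a family of matrices is insensitive to extension of scalars

Helper for the transport lemma `Summit.Langlands.Langlands.Theses.PhantomRMYoshida.PhantomRMTransport`.
For a field extension `K → L` (an algebra map) and a family of matrices `M i ∈ M_n(K)`, every
matrix `X ∈ M_n(L)` commuting with all `M i` is an `L`-linear combination of (images of) matrices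
`Y ∈ M_n(K)` commuting with all `M i`: expand the entries of `X` in a `K`-basis `θ_j` of the
finite-dimensional `K`-subspace of `L` they span, `X = ∑ θ_j • Y_j` with `Y_j ∈ M_n(K)`; then
`0 = X M_i - M_i X = ∑ θ_j • (Y_j M_i - M_i Y_j)` forces `Y_j M_i = M_i Y_j` entrywise by the
`K`-linear independence of the `θ_j`.  In the transport lemma this upgrades the hypothesis
"the commutant of `ρ̄(Γ_ℚ)` in `M₄(𝔽_p)` is `𝔽_p + 𝔽_p Φ`" to the same statement over `k ⊇ 𝔽_p`.
-/

-- `Summit.Langlands.Langlands.…` (summit = sub-problem name, D-0017 layout) trips `dupNamespace`;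
-- project-wide option (lakefile `weak.linter.dupNamespace = false`).
set_option linter.dupNamespace false
set_option autoImplicit false

namespace Summit.Langlands.Langlands.Theorems.PhantomRMTransport

open Matrix

universe u v

/-- **The commutant commutes with extension of scalars.** Let `K → L` be an extension of fields,
`M i ∈ M_n(K)` a family of matrices and `X ∈ M_n(L)` a matrix commuting with every
`algebraMap (M i)`. Then `X` lies in the `L`-span of the images of the matrices `Y ∈ M_n(K)` that
commute with every `M i`. [folklore] -/
theorem mem_span_image_commutant_of_commute {K : Type u} {L : Type v} [Field K] [Field L]
    [Algebra K L] {n : Type*} [Fintype n] [DecidableEq n] {ι : Type*} (M : ι → Matrix n n K)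
    (X : Matrix n n L)
    (hX : ∀ i, X * (M i).map (algebraMap K L) = (M i).map (algebraMap K L) * X) :
    X ∈ Submodule.span L ((fun Y : Matrix n n K => Y.map (algebraMap K L)) ''
      {Y | ∀ i, Y * M i = M i * Y}) := by
  classical
  -- the finite-dimensional `K`-subspace of `L` spanned by the entries of `X`, with a basis `θ`
  set E : Submodule K L := Submodule.span K (Set.range fun ab : n × n => X ab.1 ab.2) with hE
  haveI : FiniteDimensional K E := FiniteDimensional.span_of_finite K (Set.finite_range _)
  let θ := Module.finBasis K E
  have hmem : ∀ a b, X a b ∈ E := fun a b => Submodule.subset_span ⟨(a, b), rfl⟩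
  -- coordinates: `X a b = ∑ j, algebraMap (Y j a b) * θ j`
  let Y : Fin (Module.finrank K E) → Matrix n n K := fun j a b => θ.repr ⟨X a b, hmem a b⟩ j
  have hXsum : X = ∑ j, ((θ j : E) : L) • (Y j).map (algebraMap K L) := by
    ext a b
    have h := congrArg Subtype.val (θ.sum_repr ⟨X a b, hmem a b⟩)
    rw [Submodule.coe_sum] at h
    rw [show X a b = ((⟨X a b, hmem a b⟩ : E) : L) from rfl, ← h, Matrix.sum_apply]
    refine Finset.sum_congr rfl fun j _ => ?_
    rw [Submodule.coe_smul, Matrix.smul_apply, Matrix.map_apply, Algebra.smul_def, smul_eq_mul, mul_comm]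
  -- each `Y j` commutes with each `M i`
  have hY : ∀ j i, Y j * M i = M i * Y j := by
    intro j i
    have hlin : LinearIndependent K (fun j => ((θ j : E) : L)) :=
      θ.linearIndependent.map' E.subtype (Submodule.ker_subtype E)
    ext a b
    -- the `(a, b)` entry of `X * M i - M i * X = 0`, expanded in the basis `θ`
    have h0 : (X * (M i).map (algebraMap K L) - (M i).map (algebraMap K L) * X) a b = 0 := by
      rw [hX i, sub_self, Matrix.zero_apply]
    have hexp : (X * (M i).map (algebraMap K L) - (M i).map (algebraMap K L) * X) a b =
        ∑ j, algebraMap K L ((Y j * M i - M i * Y j) a b) * ((θ j : E) : L) := by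
      rw [hXsum, Finset.sum_mul, Finset.mul_sum, ← Finset.sum_sub_distrib, Matrix.sum_apply]
      refine Finset.sum_congr rfl fun j _ => ?_
      rw [Matrix.smul_mul, Matrix.mul_smul, ← smul_sub, Matrix.smul_apply, smul_eq_mul, mul_comm]
      congr 1
      simp only [Matrix.sub_apply, Matrix.mul_apply, Matrix.map_apply, map_sub, map_sum, map_mul]
    rw [hexp] at h0
    have := Fintype.linearIndependent_iff.1 hlin (fun j => (Y j * M i - M i * Y j) a b) (by
      simpa only [Algebra.smul_def] using h0) j
    rwa [Matrix.sub_apply, sub_eq_zero] at this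
  rw [hXsum]
  refine Submodule.sum_mem _ fun j _ => Submodule.smul_mem _ _ (Submodule.subset_span ?_)
  exact ⟨Y j, fun i => hY j i, rfl⟩

/-- Corollary used by the transport lemma: if every matrix over `K` commuting with all `M i` is of
the form `c • 1 + d • Φ`, then every matrix over `L` commuting with all `algebraMap (M i)` is of the
form `c • 1 + d • algebraMap Φ`. [folklore] -/
theorem exists_eq_smul_one_add_smul_of_commute {K : Type u} {L : Type v} [Field K] [Field L]
    [Algebra K L] {n : Type*} [Fintype n] [DecidableEq n] {ι : Type*} (M : ι → Matrix n n K)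
    (Φ : Matrix n n K)
    (hcomm : ∀ Y : Matrix n n K, (∀ i, Y * M i = M i * Y) → ∃ c d : K, Y = c • 1 + d • Φ)
    (X : Matrix n n L)
    (hX : ∀ i, X * (M i).map (algebraMap K L) = (M i).map (algebraMap K L) * X) :
    ∃ c d : L, X = c • 1 + d • Φ.map (algebraMap K L) := by
  have hmem := mem_span_image_commutant_of_commute M X hX
  -- the span of the image of the commutant is contained in `L • 1 + L • Φ`
  set P : Submodule L (Matrix n n L) :=
    Submodule.span L {(1 : Matrix n n L), Φ.map (algebraMap K L)} with hP
  have hle : Submodule.span L ((fun Y : Matrix n n K => Y.map (algebraMap K L)) ''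
      {Y | ∀ i, Y * M i = M i * Y}) ≤ P := by
    refine Submodule.span_le.2 ?_
    rintro _ ⟨Y, hYc, rfl⟩
    obtain ⟨c, d, rfl⟩ := hcomm Y hYc
    have hmap : (c • 1 + d • Φ).map (algebraMap K L) =
        algebraMap K L c • (1 : Matrix n n L) + algebraMap K L d • Φ.map (algebraMap K L) := by
      ext a b
      simp only [Matrix.map_apply, Matrix.add_apply, Matrix.smul_apply, smul_eq_mul, map_add, map_mul,
        Matrix.one_apply]
      split_ifs <;> simp
    change (c • 1 + d • Φ).map (algebraMap K L) ∈ P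
    rw [hmap]
    exact Submodule.add_mem _
      (Submodule.smul_mem _ _ (Submodule.subset_span (Set.mem_insert _ _)))
      (Submodule.smul_mem _ _
        (Submodule.subset_span (Set.mem_insert_of_mem _ (Set.mem_singleton _))))
  have hXP := hle hmem
  rw [hP, Submodule.mem_span_pair] at hXP
  obtain ⟨c, d, h⟩ := hXP
  exact ⟨c, d, h.symm⟩

end Summit.Langlands.Langlands.Theorems.PhantomRMTransport
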